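import Literature.NumberTheory.EllipticCurves.Kato2004.AdmissibleZetaClassBottomLayerProofs
import Literature.NumberTheory.EllipticCurves.Kato2004.LocPKernelRankOnePlumbing
import Literature.NumberTheory.EllipticCurves.TateModuleFreeProofs
import Summits.BirchSwinnertonDyer.Rank1Residual.Additive.KatoDescentKummerLogLinear
import Summits.BirchSwinnertonDyer.BirchSwinnertonDyer.Theorems.ErratumRoadFiveKatoFframeValueAtoms
import Literature.NumberTheory.EllipticCurves.BeilinsonKatoRankOneNonvanishing
import HarnessLib

/-!
# Crux `EulerHalfNotRamNoInertSetAtFive` (stmt-BirchSwinnertonDyer-19715), line `kato_Fframe` — **the bottom Kummer logarithm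
# of EVERY admissible zeta class is a NON-ZERO `ℤ_p`-proportional copy of the bottom Kummer logarithm of the Λ-adic lift
# of a value-pinned Kato family**: non-vanishing and `p`-adic valuation transfer along the admissible set with NO hypothesis
# on the residual image (ROUTE-INDEPENDENT module: no `Theses` import; theorems only — no definition, no named fact, no
# instance, no notation, no `sorry`)

LEAD seat `bsd-line-er5-p1` (g12), `--supports stmt-BirchSwinnertonDyer-19715`. WHY. The line's conditional closure
(`ErratumRoadFiveKatoFframeNonvanishingOfPrint` p768140 / `…ClosureOfPrint` p768192) consumes the printed rank-one
non-vanishings of the Beilinson–Kato class (Venerucci 2016; Bertolini–Darmon–Venerucci 2022 via Kim 2022) as the Literature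
named facts of `BeilinsonKatoRankOneNonvanishing.lean` (p768048), which quantify over EVERY admissible zeta class `z₀`
(`Kato2004.IsAdmissibleZetaClass W p K hK I z₀`) of every pinned cyclotomic Iwasawa cohomology `I`, while print speaks of
THE Kato class. The cell referee asked (GAP g86, 2026-08-30) whether that `∀` exceeds print on the Eisenstein stratum
(`ρ̄_{W,p}` reducible), where an admissible `z₀` might differ from a unit multiple of Kato's `𝐳_γ` by a torsion shadow. THIS
FILE answers in the kernel, with no hypothesis on the image of `ρ̄` and without Kato's Thm. 12.4: by the ACCEPTED tree theorem
`Kato2004.IsAdmissibleZetaClass.exists_proj_zero_position` (cell bsd-cm; the position clause (A6′) read at the bottom layer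
through `IwasawaH1Data.proj_zero_smul` — `Λ` acts on `proj₀` through the augmentation — and `M̃(0) ≠ 0`) every admissible `z₀`
comes with a value-pinned Kato family `(f, ι, q, Λ, c, d₁, a, A, d′; z, x)` (`ZetaBody`), its Λ-adic lift `y ∈ I.H`
(`I.proj n y = Cor z_{n+1,∅}`), the period ratio `λ = Ω⁺_f/Ω_W` and `c₁, c₂ ∈ ℤ_p ∖ {0}` with `c₁ • proj₀ z₀ = c₂ • proj₀ y` and
`v_p(c₂) = v_p(c₁) + v_p(λ/(q·R⁻_𝟙·∏_{ℓ∣A,ℓ≠p} P_ℓ(ℓ⁻¹)))`; the `ℤ_p`-homogeneity of the Kummer logarithm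
(`ContraCount.hasLocPKummerLog_smul_eq`, cell bsd-cm) then gives, for every Kummer logarithm `t` of the bottom class of `z₀`
and `s` of the bottom class of `y`: **`c₁·t = c₂·s`**, hence **`t ≠ 0 ↔ s ≠ 0`** and, when `t ≠ 0`,
**`v(t) = v(s) + v_p(λ/(q·R⁻_𝟙·∏_{ℓ∣A,ℓ≠p} P_ℓ(ℓ⁻¹)))`**. A torsion shadow cannot move `t`.

CONTENTS. §1 the two-line transfer lemma for `ℤ_p`-proportional bottom layers; §2 the packaged transfer for an admissible
class (family data + `c₁ t = c₂ s` + `t ≠ 0 ↔ s ≠ 0` + the valuation shift); §3 the PRINT SURFACE of the two named facts made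
explicit: in positive Mordell–Weil rank, «every Kummer logarithm of the bottom class of every admissible `z₀` is `≠ 0`» FOLLOWS from «every Kummer logarithm of
the bottom class of the Λ-adic lift of every value-pinned Kato family of `W` at `p` inside `I` is `≠ 0`» — the latter is what
[Venerucci2016] Thm. A/B and [BertoliniDarmonVenerucci2022] Thm. A (transcription [Kim2022] Cor. 2.3) print for the
`p`-depleted Beilinson–Kato class (Kato Thm. 12.5 (1), Ex. 13.3: the bottom class `Cor_{ℚ(μ_p)/ℚ} z_{p,∅}` of a `(c,d₁,a,A)`-family
is a non-zero rational multiple of `z_Kato`); §4 the two NAMED FACTS of p768048 AS TYPED («∀ admissible `z₀`») ⟸ {GZK, their own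
family-level forms} (`venerucci2016_of_gzk_of_family`, `bertoliniDarmonVenerucci2022_of_gzk_of_family`) — the kernel form of the
answer to referee GAP g86: the typed `∀` exceeds the family-level print statement by NOTHING image-dependent.

NUMBERS: after this file the «∀ admissible `z₀`» of p768048 §1/§2 and of the research atoms `hVsplit`/`hVnonsplit`
(`ErratumRoadFiveKatoFframeValueAtoms`, r5.6 candidate stubs `stub_valuationIneq{Split,Nonsplit}`) is reduced IN THE KERNEL to
ONE value-pinned family per datum, with the explicit valuation shift a research prover of the (α2) items needs.

HONEST FRAMING: theorems about the tree's Kato-currency objects only; nothing about the values `s` themselves (Perrin-Riou's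
conjecture, integral or rational) is asserted; closes nothing; credits no registered stub. No summit statement is proved;
BSD is proved for no curve.

References: [Kato2004Asterisque] Thm. 12.5 (1) (pp. 221–222), Ex. 13.3 (p. 225), §13.9 and Lemma 13.10 (1) (pp. 229–230),
§14.14 (14.14.1) (p. 243); [BlochKato1990] Def. 3.10, Ex. 3.11; [Venerucci2016] Thm. A, Thm. B; [BertoliniDarmonVenerucci2022]
Thm. A; [Kim2022] Thm. 2.1, Cor. 2.3; tree: `Kato2004/AdmissibleZetaClassBottomLayerProofs.lean`
(`IsAdmissibleZetaClass.exists_proj_zero_position`), `Kato2004/LocPKernelRankOnePlumbing.lean` (`layerZeroToTop_smul`),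
`Rank1Residual/Additive/KatoDescentKummerLogLinear.lean` (`ContraCount.hasLocPKummerLog_smul_eq`),
`TateModuleFreeProofs.lean` (`module_free_tateModule_holds`, `module_finite_tateModule_holds` — the two structure-fact instance
binders `[Module.Free ℤ_[p] (T_pW)]`, `[Module.Finite ℤ_[p] (T_pW)]` of §2–§3 are THEOREMS of the tree, supplied by `haveI`).
-/

-- the summit and its single problem are both named `BirchSwinnertonDyer` (registry layout D-0017)
set_option linter.dupNamespace false
set_option autoImplicit false

noncomputable section

open scoped BigOperators NumberField TensorProduct Classical
open Field IsDedekindDomain NumberField CongruenceSubgroup ValuativeRel WeierstrassCurve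
open Literature.NumberTheory.GaloisRepresentations
open Literature.NumberTheory.GaloisRepresentations.PeriodRingData
open Literature.NumberTheory.GaloisRepresentations.IsNonarchimedeanLocalField
open Literature.NumberTheory.PAdicHodge
open Literature.NumberTheory.EllipticCurves Literature.NumberTheory.EllipticCurves.ModularForms
open Literature.NumberTheory.EllipticCurves.Kato2004 Literature.NumberTheory.EllipticCurves.Kato2004.EulerSystemValues
open Literature.NumberTheory.AdelicBaseChange Literature.NumberTheory.Automorphic
open Summit.BirchSwinnertonDyer.Rank1Residual.Additive

namespace Summit.BirchSwinnertonDyer.BirchSwinnertonDyer.Theorems.ErratumRoadFiveKatoFframeAdmissibleLogTransfer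

/-! ## §1 Transfer of the Kummer logarithm along `ℤ_p`-proportional bottom layers -/

section Transfer

variable (W : WeierstrassCurve ℚ) [W.IsElliptic] [W.IsGloballyMinimal] (p : ℕ) [Fact p.Prime]
  [ContinuousSMul ℤ_[p] (W.tateModule p)] {K : ZpExtension ℚ p} {γ : absoluteGaloisGroup ℚ} (I : IwasawaH1Data W p K γ)

/-- **`c₁ • proj₀ z₀ = c₂ • proj₀ y` ⟹ `c₁·t = c₂·s`** for every Kummer logarithm `t` of the bottom class of `z₀` and `s` of the
bottom class of `y` (`layerZeroToTop` is `ℤ_p`-linear; the Kummer logarithm is `ℤ_p`-homogeneous and unique —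
`ContraCount.hasLocPKummerLog_smul_eq`). [cite: BlochKato1990, Def. 3.10 and Ex. 3.11] [cite: Kato2004Asterisque, §14.14 (14.14.1) (p. 243)] -/
theorem kummerLog_mul_eq_of_proj_zero_smul_eq {z₀ y : I.H} {c₁ c₂ : ℤ_[p]}
    (h : c₁ • I.proj 0 z₀ = c₂ • I.proj 0 y) {t s : ℚ_[p]}
    (ht : HasLocPKummerLog W p (layerZeroToTop W p K (I.proj 0 z₀)) t)
    (hs : HasLocPKummerLog W p (layerZeroToTop W p K (I.proj 0 y)) s) :
    (c₁ : ℚ_[p]) * t = (c₂ : ℚ_[p]) * s := by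
  refine ContraCount.hasLocPKummerLog_smul_eq W p ?_ ht hs
  rw [← layerZeroToTop_smul, ← layerZeroToTop_smul, h]

/-- **Non-vanishing transfer**: with `c₁, c₂ ≠ 0`, `c₁ • proj₀ z₀ = c₂ • proj₀ y` gives `t ≠ 0 ↔ s ≠ 0` for the bottom Kummer
logarithms. [cite: BlochKato1990, Ex. 3.11] -/
theorem kummerLog_ne_zero_iff_of_proj_zero_smul_eq {z₀ y : I.H} {c₁ c₂ : ℤ_[p]} (hc₁ : c₁ ≠ 0) (hc₂ : c₂ ≠ 0)
    (h : c₁ • I.proj 0 z₀ = c₂ • I.proj 0 y) {t s : ℚ_[p]}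
    (ht : HasLocPKummerLog W p (layerZeroToTop W p K (I.proj 0 z₀)) t)
    (hs : HasLocPKummerLog W p (layerZeroToTop W p K (I.proj 0 y)) s) :
    t ≠ 0 ↔ s ≠ 0 := by
  have hkey := kummerLog_mul_eq_of_proj_zero_smul_eq W p I h ht hs
  have h₁ : (c₁ : ℚ_[p]) ≠ 0 := PadicInt.coe_ne_zero.mpr hc₁
  have h₂ : (c₂ : ℚ_[p]) ≠ 0 := PadicInt.coe_ne_zero.mpr hc₂
  constructor
  · intro ht0 hs0
    rw [hs0, mul_zero, mul_eq_zero] at hkey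
    exact hkey.elim h₁ ht0
  · intro hs0 ht0
    rw [ht0, mul_zero, eq_comm, mul_eq_zero] at hkey
    exact hkey.elim h₂ hs0

/-- **Valuation transfer**: with `c₁, c₂ ≠ 0`, `c₁ • proj₀ z₀ = c₂ • proj₀ y` and `t ≠ 0`, the bottom Kummer logarithms satisfy
`v(t) + v(c₁) = v(s) + v(c₂)` (`ℚ_p`-valuations). [cite: BlochKato1990, Ex. 3.11] -/
theorem valuation_kummerLog_add_eq_of_proj_zero_smul_eq {z₀ y : I.H} {c₁ c₂ : ℤ_[p]} (hc₁ : c₁ ≠ 0) (hc₂ : c₂ ≠ 0)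
    (h : c₁ • I.proj 0 z₀ = c₂ • I.proj 0 y) {t s : ℚ_[p]}
    (ht : HasLocPKummerLog W p (layerZeroToTop W p K (I.proj 0 z₀)) t)
    (hs : HasLocPKummerLog W p (layerZeroToTop W p K (I.proj 0 y)) s) (ht0 : t ≠ 0) :
    t.valuation + ((c₁ : ℤ_[p]) : ℚ_[p]).valuation = s.valuation + ((c₂ : ℤ_[p]) : ℚ_[p]).valuation := by
  have hkey := kummerLog_mul_eq_of_proj_zero_smul_eq W p I h ht hs
  have hs0 : s ≠ 0 := (kummerLog_ne_zero_iff_of_proj_zero_smul_eq W p I hc₁ hc₂ h ht hs).mp ht0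
  have h₁ : (c₁ : ℚ_[p]) ≠ 0 := PadicInt.coe_ne_zero.mpr hc₁
  have h₂ : (c₂ : ℚ_[p]) ≠ 0 := PadicInt.coe_ne_zero.mpr hc₂
  have hv := congrArg Padic.valuation hkey
  rw [Padic.valuation_mul h₁ ht0, Padic.valuation_mul h₂ hs0] at hv
  omega

end Transfer

/-! ## §2 The packaged transfer for an admissible zeta class -/

section Admissible

variable (W : WeierstrassCurve ℚ) [W.IsElliptic] [W.IsGloballyMinimal] (p : ℕ) [Fact p.Prime]
  [ContinuousSMul ℤ_[p] (W.tateModule p)] [Module.Free ℤ_[p] (W.tateModule p)] [Module.Finite ℤ_[p] (W.tateModule p)]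
  (K : ZpExtension ℚ p) (hK : K.IsCyclotomic) {γ : absoluteGaloisGroup ℚ} (I : IwasawaH1Data W p K γ) (z₀ : I.H)

/-- **THE TRANSFER for an admissible class.** If `z₀ ∈ I.H = 𝐇¹_Γ(T_pW)` is admissible, there are: `p ≠ 2`, the newform `f`
of `W` (level `N`), a value datum `(ι, q, Λ)` with `q ≠ 0`, Kato parameters `(c, d₁, a, A, d′)` with the printed guards and
`R⁻_𝟙 ≠ 0`, THE value-pinned family `(z, x)` (`ZetaBody W p f ι q Λ c d₁ a A z x`), its Λ-adic lift `y ∈ I.H`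
(`I.proj n y = Cor(z_{n+1,∅})` for all `n`), the period ratio `λ ≠ 0` (`Ω⁺_f = λ·Ω_W`) and `c₁, c₂ ∈ ℤ_p ∖ {0}` with
`c₁ • proj₀ z₀ = c₂ • proj₀ y`, such that for EVERY Kummer logarithm `t` of the bottom class of `z₀` and `s` of the bottom class
of `y`: **`c₁·t = c₂·s`**, **`t ≠ 0 ↔ s ≠ 0`**, and **`t ≠ 0 → v(t) = v(s) + v_p(λ/(q·R⁻_𝟙·∏_{ℓ∣A,ℓ≠p} P_ℓ(ℓ⁻¹)))`**. No hypothesis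
on the residual image; Kato's Thm. 12.4 is not used. Kernel: `Kato2004.IsAdmissibleZetaClass.exists_proj_zero_position` + §1.
[cite: Kato2004Asterisque, Thm. 12.5 (1) (pp. 221–222), Lemma 13.10 (1) (p. 230), §14.14 (14.14.1) (p. 243)] [cite: BlochKato1990, Ex. 3.11] -/
theorem exists_family_kummerLog_transfer_of_isAdmissibleZetaClass (hz : IsAdmissibleZetaClass W p K hK I z₀) :
    ∃ (hp : p ≠ 2) (N : ℕ) (_ : NeZero N) (f : CuspForm (Gamma0 N) 2) (_ : IsNewformOf W f)
      (ι : (n : ℕ) → (CyclotomicField n ℚ →+* ℂ)) (q : ℚ)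
      (Λ : ∀ (k : ℕ) (r : Finset (HeightOneSpectrum (𝓞 ℚ))),
        H1 (tateRep W p) (cycSubgroup p k r) →ₗ[ℤ_[p]] ℚ_[p] ⊗[ℚ] CyclotomicField (cycLevel p k r) ℚ)
      (c d₁ a : ℤ) (A : ℕ) (d' : ℤ)
      (z : ∀ (k : ℕ) (r : (cyclotomicLevelsRat p (badPlaces c d₁ A N)).Ideals),
        H1 (tateRep W p) ((cyclotomicLevelsRat p (badPlaces c d₁ A N)).level k r.1))
      (x : ∀ (k : ℕ) (r : (cyclotomicLevelsRat p (badPlaces c d₁ A N)).Ideals),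
        CyclotomicField (cycLevel p k r.1) ℚ)
      (y : I.H) (perRatio : ℚ) (c₁ c₂ : ℤ_[p]),
      q ≠ 0 ∧ ZetaBody W p f ι ((q : ℚ) : ℝ) Λ c d₁ a A z x ∧
      (∀ n : ℕ, I.proj n y =
        levelToLayer W p hK hp (badPlaces c d₁ A N) n
          (z (n + 1) (cyclotomicLevelsRat p (badPlaces c d₁ A N)).idealOne)) ∧
      0 < A ∧ Int.gcd c (6 * p * A) = 1 ∧ Int.gcd d₁ (6 * p * N) = 1 ∧ (d₁ : ℤ) * d' ≡ 1 [ZMOD (A : ℤ)] ∧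
      ratCuspFactor f true c d₁ a A d' ≠ 0 ∧ perRatio ≠ 0 ∧
      plusPeriod f = ((perRatio : ℚ) : ℝ) * W.realPeriodRat ∧
      c₁ ≠ 0 ∧ c₂ ≠ 0 ∧ c₁ • I.proj 0 z₀ = c₂ • I.proj 0 y ∧
      ∀ t s : ℚ_[p], HasLocPKummerLog W p (layerZeroToTop W p K (I.proj 0 z₀)) t →
        HasLocPKummerLog W p (layerZeroToTop W p K (I.proj 0 y)) s →
        (c₁ : ℚ_[p]) * t = (c₂ : ℚ_[p]) * s ∧ (t ≠ 0 ↔ s ≠ 0) ∧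
        (t ≠ 0 → t.valuation = s.valuation +
          padicValRat p (perRatio /
            (q * ratCuspFactor f true c d₁ a A d' * ∏ ℓ ∈ A.primeFactors.erase p, eulerFactorAtOne W N ℓ))) := by
  obtain ⟨hp, N, hN, f, hf, ι, q, Λ, c, d₁, a, A, d', z, x, y, perRatio, c₁, c₂, hq, hzeta, hy, hA, hc, hd, hdd',
    hR, hper0, hper, hc₁, hc₂, hkey, hval⟩ := hz.exists_proj_zero_position
  refine ⟨hp, N, hN, f, hf, ι, q, Λ, c, d₁, a, A, d', z, x, y, perRatio, c₁, c₂, hq, hzeta, hy, hA, hc, hd, hdd',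
    hR, hper0, hper, hc₁, hc₂, hkey, fun t s ht hs => ⟨kummerLog_mul_eq_of_proj_zero_smul_eq W p I hkey ht hs,
      kummerLog_ne_zero_iff_of_proj_zero_smul_eq W p I hc₁ hc₂ hkey ht hs, fun ht0 => ?_⟩⟩
  have hv := valuation_kummerLog_add_eq_of_proj_zero_smul_eq W p I hc₁ hc₂ hkey ht hs ht0
  rw [hval] at hv
  omega

end Admissible

/-! ## §3 The print surface of the «∀ admissible `z₀`» non-vanishing facts -/

section PrintSurface

variable (W : WeierstrassCurve ℚ) [W.IsElliptic] [W.IsGloballyMinimal] (p : ℕ) [Fact p.Prime]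
  [ContinuousSMul ℤ_[p] (W.tateModule p)] [Module.Free ℤ_[p] (W.tateModule p)] [Module.Finite ℤ_[p] (W.tateModule p)]
  (K : ZpExtension ℚ p) (hK : K.IsCyclotomic) {γ : absoluteGaloisGroup ℚ} (I : IwasawaH1Data W p K γ)

/-- **«Every Kummer logarithm of the bottom class of every ADMISSIBLE `z₀ ∈ I.H` is `≠ 0`» FOLLOWS from «every Kummer logarithm
of the bottom class of the Λ-adic lift `y ∈ I.H` of every value-pinned Kato family of `W` at `p` (newform `f`, datum `(ι, q, Λ)`,
`q ≠ 0`, parameters `(c, d₁, a, A, d′)` with the printed guards and `R⁻_𝟙 ≠ 0`, `ZetaBody`, `I.proj n y = Cor z_{n+1,∅}`) is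
`≠ 0`», in positive Mordell–Weil rank (where every bottom class HAS a Kummer logarithm:
`ErratumRoadFiveKatoFframeValueAtoms.exists_hasLocPKummerLog_bottomClass`)** — the print surface of the named facts `Venerucci2016_kummerLog_bottomLayer_ne_zero_split` /
`BertoliniDarmonVenerucci2022_kummerLog_bottomLayer_ne_zero` (p768048): the bottom class of such a `y` is the `p`-depleted
Beilinson–Kato class of `W` up to a non-zero rational (Kato Thm. 12.5 (1), Ex. 13.3), whose non-vanishing at `p` in analytic rank
one is what [Venerucci2016] Thm. A/B and [BertoliniDarmonVenerucci2022] Thm. A ([Kim2022] Cor. 2.3) print. No hypothesis on the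
residual image. [cite: Kato2004Asterisque, Thm. 12.5 (1) (pp. 221–222), Ex. 13.3 (p. 225), Lemma 13.10 (1) (p. 230)]
[cite: Venerucci2016, Thm. A and Thm. B] [cite: BertoliniDarmonVenerucci2022, Thm. A] [cite: Kim2022, Cor. 2.3] -/
theorem forall_isAdmissibleZetaClass_kummerLog_ne_zero_of_forall_family (hr : W.mordellWeilRank ≠ 0)
    (hfam : ∀ (hp : p ≠ 2) (N : ℕ) [NeZero N] (f : CuspForm (Gamma0 N) 2), IsNewformOf W f →
      ∀ (ι : (n : ℕ) → (CyclotomicField n ℚ →+* ℂ)) (q : ℚ)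
        (Λ : ∀ (k : ℕ) (r : Finset (HeightOneSpectrum (𝓞 ℚ))),
          H1 (tateRep W p) (cycSubgroup p k r) →ₗ[ℤ_[p]] ℚ_[p] ⊗[ℚ] CyclotomicField (cycLevel p k r) ℚ)
        (c d₁ a : ℤ) (A : ℕ) (d' : ℤ)
        (z : ∀ (k : ℕ) (r : (cyclotomicLevelsRat p (badPlaces c d₁ A N)).Ideals),
          H1 (tateRep W p) ((cyclotomicLevelsRat p (badPlaces c d₁ A N)).level k r.1))
        (x : ∀ (k : ℕ) (r : (cyclotomicLevelsRat p (badPlaces c d₁ A N)).Ideals),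
          CyclotomicField (cycLevel p k r.1) ℚ)
        (y : I.H),
        q ≠ 0 → ZetaBody W p f ι ((q : ℚ) : ℝ) Λ c d₁ a A z x →
        (∀ n : ℕ, I.proj n y =
          levelToLayer W p hK hp (badPlaces c d₁ A N) n
            (z (n + 1) (cyclotomicLevelsRat p (badPlaces c d₁ A N)).idealOne)) →
        0 < A → Int.gcd c (6 * p * A) = 1 → Int.gcd d₁ (6 * p * N) = 1 → (d₁ : ℤ) * d' ≡ 1 [ZMOD (A : ℤ)] →
        ratCuspFactor f true c d₁ a A d' ≠ 0 →
        ∀ s : ℚ_[p], HasLocPKummerLog W p (layerZeroToTop W p K (I.proj 0 y)) s → s ≠ 0)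
    (z₀ : I.H) (hz : IsAdmissibleZetaClass W p K hK I z₀)
    (t : ℚ_[p]) (ht : HasLocPKummerLog W p (layerZeroToTop W p K (I.proj 0 z₀)) t) : t ≠ 0 := by
  obtain ⟨hp, N, hN, f, hf, ι, q, Λ, c, d₁, a, A, d', z, x, y, perRatio, c₁, c₂, hq, hzeta, hy, hA, hc, hd, hdd',
    hR, -, -, hc₁, hc₂, hkey, htr⟩ := exists_family_kummerLog_transfer_of_isAdmissibleZetaClass W p K hK I z₀ hz
  -- in positive rank the bottom class of `y` HAS a Kummer logarithm `s` (Kurihara–Pollack line, tree theorem)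
  obtain ⟨s, hs⟩ := ErratumRoadFiveKatoFframeValueAtoms.exists_hasLocPKummerLog_bottomClass W p hr K I y
  exact ((htr t s ht hs).2.1).mpr (hfam hp N f hf ι q Λ c d₁ a A d' z x y hq hzeta hy hA hc hd hdd' hR s hs)

end PrintSurface

/-! ## §4 The two named facts of p768048 AS TYPED ⟸ GZK + their family-level (print-shaped) forms -/

section NamedFacts

/-- **`Venerucci2016_kummerLog_bottomLayer_ne_zero_split` (p768048 §1, «∀ admissible `z₀`») ⟸ {GZK, the SAME statement at the
level of value-pinned Kato families}**: the family-level form says — under Venerucci's hypotheses `3 < p`, `W` split multiplicative at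
`p`, `W[p]` irreducible, `ord_{s=1} L(W,s) = 1` — that every Kummer logarithm of the bottom class `Cor_{ℚ(μ_p)/ℚ} z_{p,∅}` of the
Λ-adic lift `y ∈ I.H` of every value-pinned Kato family of `W` at `p` is `≠ 0` (print: [Venerucci2016] Thm. A/B for the
`p`-depleted Beilinson–Kato class `ζ^BK`, a non-zero rational multiple of that bottom class by Kato Thm. 12.5 (1) / Ex. 13.3); GZK
turns `ord_{s=1} L = 1` into positive Mordell–Weil rank, and §3 transfers along the admissible set. No hypothesis on `ρ̄` beyond
Venerucci's own. CONDITIONAL (GZK + the family-level binder); mints nothing. [cite: Venerucci2016, Thm. A and Thm. B (pp. 3–4)]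
[cite: Kato2004Asterisque, Thm. 12.5 (1) (pp. 221–222), Ex. 13.3 (p. 225)] [cite: GrossZagier1986, Thm. I.(7.3)] -/
theorem venerucci2016_of_gzk_of_family (hGZK : rank_eq_analyticRank_of_analyticRank_le_one)
    (hVfam : ∀ (W : WeierstrassCurve ℚ) [W.IsElliptic] [W.IsGloballyMinimal] (p : ℕ) [Fact p.Prime]
      [ContinuousSMul ℤ_[p] (W.tateModule p)] [Module.Free ℤ_[p] (W.tateModule p)] [Module.Finite ℤ_[p] (W.tateModule p)],
      3 < p → W.HasSplitMultiplicativeReductionAtPrime p → W.HasIrreducibleModPGaloisRep p → W.analyticRank = 1 →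
      ∀ (K : ZpExtension ℚ p) (hK : K.IsCyclotomic) (γ : absoluteGaloisGroup ℚ) (I : IwasawaH1Data W p K γ),
        K.IsTopGenerator γ →
      ∀ (hp : p ≠ 2) (N : ℕ) [NeZero N] (f : CuspForm (Gamma0 N) 2), IsNewformOf W f →
      ∀ (ι : (n : ℕ) → (CyclotomicField n ℚ →+* ℂ)) (q : ℚ)
        (Λ : ∀ (k : ℕ) (r : Finset (HeightOneSpectrum (𝓞 ℚ))),
          H1 (tateRep W p) (cycSubgroup p k r) →ₗ[ℤ_[p]] ℚ_[p] ⊗[ℚ] CyclotomicField (cycLevel p k r) ℚ)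
        (c d₁ a : ℤ) (A : ℕ) (d' : ℤ)
        (z : ∀ (k : ℕ) (r : (cyclotomicLevelsRat p (badPlaces c d₁ A N)).Ideals),
          H1 (tateRep W p) ((cyclotomicLevelsRat p (badPlaces c d₁ A N)).level k r.1))
        (x : ∀ (k : ℕ) (r : (cyclotomicLevelsRat p (badPlaces c d₁ A N)).Ideals),
          CyclotomicField (cycLevel p k r.1) ℚ)
        (y : I.H),
        q ≠ 0 → ZetaBody W p f ι ((q : ℚ) : ℝ) Λ c d₁ a A z x →
        (∀ n : ℕ, I.proj n y =
          levelToLayer W p hK hp (badPlaces c d₁ A N) n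
            (z (n + 1) (cyclotomicLevelsRat p (badPlaces c d₁ A N)).idealOne)) →
        0 < A → Int.gcd c (6 * p * A) = 1 → Int.gcd d₁ (6 * p * N) = 1 → (d₁ : ℤ) * d' ≡ 1 [ZMOD (A : ℤ)] →
        ratCuspFactor f true c d₁ a A d' ≠ 0 →
        ∀ s : ℚ_[p], HasLocPKummerLog W p (layerZeroToTop W p K (I.proj 0 y)) s → s ≠ 0) :
    Venerucci2016_kummerLog_bottomLayer_ne_zero_split := by
  intro W _ _ p _ _ h3 hsplit hirr hr K hK γ I z₀ hγ hz t ht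
  haveI : Module.Free ℤ_[p] (W.tateModule p) := module_free_tateModule_holds W p
  haveI : Module.Finite ℤ_[p] (W.tateModule p) := module_finite_tateModule_holds W p
  have hmw : W.mordellWeilRank ≠ 0 := by
    have h := (hGZK W (le_of_eq hr)).1
    omega
  exact forall_isAdmissibleZetaClass_kummerLog_ne_zero_of_forall_family W p K hK I hmw
    (fun hp N _ f hf ι q Λ c d₁ a A d' z x y hq hzeta hy hA hc hd hdd' hR s hs =>
      hVfam W p h3 hsplit hirr hr K hK γ I hγ hp N f hf ι q Λ c d₁ a A d' z x y hq hzeta hy hA hc hd hdd' hR s hs)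
    z₀ hz t ht

/-- **`BertoliniDarmonVenerucci2022_kummerLog_bottomLayer_ne_zero` (p768048 §2, «∀ admissible `z₀`») ⟸ {GZK, the SAME statement at
the level of value-pinned Kato families}**: the family-level form says — under the transcribed hypotheses `p ≠ 2`, `p² ∤ N_W`,
`ord_{s=1} L(W,s) = 1` ([Kim2022] Thm. 2.1 / Cor. 2.3), NO hypothesis on `ρ̄_{W,p}` — that every Kummer logarithm of the bottom class
of the Λ-adic lift `y ∈ I.H` of every value-pinned Kato family of `W` at `p` is `≠ 0` (print: «`res_p(z_Kato)` is non-zero», `z_Kato`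
a non-zero rational multiple of that bottom class by Kato Thm. 12.5 (1) / Ex. 13.3); GZK gives positive rank and §3 transfers along
the admissible set — the Eisenstein stratum included. CONDITIONAL (GZK + the family-level binder); mints nothing.
[cite: BertoliniDarmonVenerucci2022, Thm. A] [cite: Kim2022, Thm. 2.1 and Cor. 2.3] [cite: Kato2004Asterisque, Thm. 12.5 (1) (pp. 221–222), Ex. 13.3 (p. 225)]
[cite: GrossZagier1986, Thm. I.(7.3)] -/
theorem bertoliniDarmonVenerucci2022_of_gzk_of_family (hGZK : rank_eq_analyticRank_of_analyticRank_le_one)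
    (hBfam : ∀ (W : WeierstrassCurve ℚ) [W.IsElliptic] [W.IsGloballyMinimal] (p : ℕ) [Fact p.Prime]
      [ContinuousSMul ℤ_[p] (W.tateModule p)] [Module.Free ℤ_[p] (W.tateModule p)] [Module.Finite ℤ_[p] (W.tateModule p)],
      p ≠ 2 → ¬ p ^ 2 ∣ W.conductorNorm ℤ → W.analyticRank = 1 →
      ∀ (K : ZpExtension ℚ p) (hK : K.IsCyclotomic) (γ : absoluteGaloisGroup ℚ) (I : IwasawaH1Data W p K γ),
        K.IsTopGenerator γ →
      ∀ (hp : p ≠ 2) (N : ℕ) [NeZero N] (f : CuspForm (Gamma0 N) 2), IsNewformOf W f →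
      ∀ (ι : (n : ℕ) → (CyclotomicField n ℚ →+* ℂ)) (q : ℚ)
        (Λ : ∀ (k : ℕ) (r : Finset (HeightOneSpectrum (𝓞 ℚ))),
          H1 (tateRep W p) (cycSubgroup p k r) →ₗ[ℤ_[p]] ℚ_[p] ⊗[ℚ] CyclotomicField (cycLevel p k r) ℚ)
        (c d₁ a : ℤ) (A : ℕ) (d' : ℤ)
        (z : ∀ (k : ℕ) (r : (cyclotomicLevelsRat p (badPlaces c d₁ A N)).Ideals),
          H1 (tateRep W p) ((cyclotomicLevelsRat p (badPlaces c d₁ A N)).level k r.1))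
        (x : ∀ (k : ℕ) (r : (cyclotomicLevelsRat p (badPlaces c d₁ A N)).Ideals),
          CyclotomicField (cycLevel p k r.1) ℚ)
        (y : I.H),
        q ≠ 0 → ZetaBody W p f ι ((q : ℚ) : ℝ) Λ c d₁ a A z x →
        (∀ n : ℕ, I.proj n y =
          levelToLayer W p hK hp (badPlaces c d₁ A N) n
            (z (n + 1) (cyclotomicLevelsRat p (badPlaces c d₁ A N)).idealOne)) →
        0 < A → Int.gcd c (6 * p * A) = 1 → Int.gcd d₁ (6 * p * N) = 1 → (d₁ : ℤ) * d' ≡ 1 [ZMOD (A : ℤ)] →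
        ratCuspFactor f true c d₁ a A d' ≠ 0 →
        ∀ s : ℚ_[p], HasLocPKummerLog W p (layerZeroToTop W p K (I.proj 0 y)) s → s ≠ 0) :
    BertoliniDarmonVenerucci2022_kummerLog_bottomLayer_ne_zero := by
  intro W _ _ p _ _ hp2 hN hr K hK γ I z₀ hγ hz t ht
  haveI : Module.Free ℤ_[p] (W.tateModule p) := module_free_tateModule_holds W p
  haveI : Module.Finite ℤ_[p] (W.tateModule p) := module_finite_tateModule_holds W p
  have hmw : W.mordellWeilRank ≠ 0 := by
    have h := (hGZK W (le_of_eq hr)).1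
    omega
  exact forall_isAdmissibleZetaClass_kummerLog_ne_zero_of_forall_family W p K hK I hmw
    (fun hp N _ f hf ι q Λ c d₁ a A d' z x y hq hzeta hy hA hc hd hdd' hR s hs =>
      hBfam W p hp2 hN hr K hK γ I hγ hp N f hf ι q Λ c d₁ a A d' z x y hq hzeta hy hA hc hd hdd' hR s hs)
    z₀ hz t ht

end NamedFacts

end Summit.BirchSwinnertonDyer.BirchSwinnertonDyer.Theorems.ErratumRoadFiveKatoFframeAdmissibleLogTransfer

end
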